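import Mathlib.Analysis.Calculus.FDeriv.Analytic
import Literature.NumberTheory.LFunctions.XiMultiplePositivity
import Literature.NumberTheory.LFunctions.ZetaLogDerivSeries
import Literature.NumberTheory.LFunctions.GeneralizedRH
import Literature.Analysis.TotalPositivity.PolyaFrequencyClosure
import Literature.Analysis.TotalPositivity.PolyaFrequencyZeros
import Literature.Analysis.Complex.HadamardGenusZeroProofs
import Literature.Analysis.TotalPositivity.FeketeCriterion
import Literature.Analysis.TotalPositivity.ToeplitzMinorAsymptotics
import Literature.NumberTheory.LFunctions.JensenAsymptoticsFactorial
import HarnessLib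

/-!
# Katkova's `RH ⇔ ξ₁ ∈ PF_∞` (proved): `Literature.NumberTheory.LFunctions.katkova_rh_iff_pf_holds`

Trunk T-NT-LFUNC (Literature/NumberTheory/LFunctions). Discharges the named fact
`Literature.NumberTheory.LFunctions.katkova_rh_iff_pf` (XiMultiplePositivity.lean) [Katkova 2006, §1, Thm. C and the sentence
following it, arXiv p. 4: "So, the Riemann Hypothesis is equivalent to statement that
`ξ₁ ∈ PF_∞`"]. Katkova's argument (arXiv pp. 3–4) has two halves:

1. (Pólya) `ξ₁(z) := ξ(√z + 1/2) = Σ b_k z^k` [Katkova 2006, §1 eq. (6)] is an entire function of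
   order `1/2` with `ξ₁(0) > 0`, and RH `⇔` all zeros of `ξ₁` are real and negative;
2. (Thm. C, from Thm. ASWE = Aissen–Schoenberg–Whitney–Edrei + Hadamard) an ENTIRE `f` is in
   `PF_∞` iff `f ∈ L-P⁺`; for `f` of order `< 1` with real Taylor coefficients and `f(0) > 0`
   this reads: the Taylor sequence of `f` is a Pólya frequency sequence iff all zeros of `f` are
   real `≤ 0`.

Half 2 is the named fact `Literature.Analysis.TotalPositivity.pf_taylor_iff_zeros_of_order_lt_one`
(PolyaFrequency.lean), DISCHARGED in the tree from Hadamard's genus-zero factorisation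
(`Literature.Analysis.Complex.hadamard_genus_zero_holds`, HadamardGenusZeroProofs.lean) by
`Literature.Analysis.TotalPositivity.pf_taylor_iff_zeros_of_order_lt_one_of_hadamard` (PolyaFrequencyZeros.lean:
`⇐` = closure of Pólya frequency sequences under products `∏ (1 + αᵢ z)` and locally uniform
limits, PolyaFrequencyEntire.lean; `⇒` = the Aissen–Schoenberg–Whitney deflation argument,
PolyaFrequencyDeflation.lean + PolyaFrequencyZeros.lean). Here we prove half 1 for the tree's
objects and assemble.

**Dictionary.** Katkova's `ξ₁` is LITERALLY the tree's `Literature.NumberTheory.LFunctions.xiSq` (ZetaLogDerivSeries.lean):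
`xiSq = Σₙ bₙ zⁿ` with `bₙ = xiSqCoeff n = γ(n)/(8·n!)` (`γ = Literature.xiTaylorCoeff`, GORZ) and
`xiSq (w²) = ξ(1/2 + w)` (`xiSq_sq`); the route's / the fact's sequence is `aₙ = γ(n)/n! = 8 bₙ`,
and multiplying a sequence by `8` or `8⁻¹` preserves the Pólya frequency property
(`IsPolyaFrequencySeq.smul`).

* `hasFPowerSeriesOnBall_xiSq`, `iteratedDeriv_xiSq_zero : ξ₁⁽ⁿ⁾(0) = n! · bₙ`,
  `im_iteratedDeriv_xiSq` (real Taylor coefficients), `re_iteratedDeriv_xiSq_div :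
  ξ₁⁽ⁿ⁾(0)/n! = 8⁻¹ · aₙ`.
* `riemannHypothesis_iff_re_eq_zero` : RH `↔ ∀ z, ξ(1/2 + z) = 0 → re z = 0`
  (`riemannXi_eq_zero_iff_holds` + `riemannHypothesis_iff_strip_holds`);
  `xiSq_zeros_iff_riemannHypothesis` : (all zeros of `ξ₁` real `≤ 0`) `↔ RiemannHypothesis`
  (Pólya's half: the previous item with `w = z²`).
* `isEntireOfOrderLtOne_xiSq` : `ξ₁` is entire of order `< 1` (`‖ξ₁ w‖ ≤ C exp(‖w‖^{7/8})`,
  `norm_xiSq_le`, from Titchmarsh's `ξ(s) = O(e^{A|s|log|s|})`, `riemannXi_order_le_one_holds`).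
* `riemannXi_half_re_pos : 0 < ξ(1/2)` (`= ξ₁(0)`; Katkova: "`ξ₁(0) > 0`"), from
  `ξ(1/2) = -Γ_ℝ(1/2) ζ(1/2)/8`, `Γ_ℝ(1/2) = π^{-1/4} Γ(1/4) > 0` and `ζ(1/2) < 0`
  (`riemannZeta_re_neg_of_pos_of_lt_one`, ZetaRealAxis.lean); `xiTaylorCoeff_zero_pos : 0 < γ(0)`
  (the instance `n = 0` of the named fact `Literature.NumberTheory.LFunctions.xiTaylorCoeff_pos`, proved).
* `isPolyaFrequencySeq_taylor_xiSq_iff` : `(ξ₁⁽ⁿ⁾(0)/n!)ₙ` is PF `↔ (γ(n)/n!)ₙ` is PF.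
* `katkova_rh_iff_pf_of_pf_taylor : pf_taylor_iff_zeros_of_order_lt_one → katkova_rh_iff_pf`
  (the reduction of Katkova's equivalence to Thm. C) and
  `katkova_rh_iff_pf_holds : katkova_rh_iff_pf`, the former fed with
  `pf_taylor_iff_zeros_of_order_lt_one_of_hadamard hadamard_genus_zero_holds`;
  `riemannHypothesis_iff_isPolyaFrequencySeq_xi` : RH `↔ IsPolyaFrequencySeq (γ(n)/n!)`.

Nothing is assumed: every input of the printed proof (Pólya's half, the order of `ξ`,
`ξ(1/2) > 0`, Hadamard's theorem in genus `0`, the entire genus-zero case of ASWE) is proved in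
the tree.

## Katkova's Theorem 2 (`ξ₁ ∈ APF_m`): `Literature.NumberTheory.LFunctions.katkova_apf_holds`

Also discharged here (appended): the named facts `Literature.NumberTheory.LFunctions.katkova_consecutive_minors_pos`
[Katkova 2006, §2, the display after Prop. 1: `∀ m ∃ N(m) ∀ k ≥ N(m) ∀ ν ≤ m: A_k^ν > 0`] and
`Literature.NumberTheory.LFunctions.katkova_apf` [Katkova 2006, Thm. 2 with Def. 3]. Katkova's route is Prop. 1 (saddle
point for `ν`-fold integrals, §§2–4) + Lemma 2 ⇒ consecutive minors positive ⇒ (Thm. D =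
Fekete's criterion) all minors of `A_N` positive. The tree proves the two arrows as printed and
replaces the saddle point by the GORZ asymptotics it already has:

* `katkova_consecutive_minors_pos_holds`: the GORZ-type expansion (15) for `a_n = γ(n)/n!`
  (`Literature.NumberTheory.LFunctions.GORZAsymp.xiTaylorCoeff_div_factorial_logRatio`, `JensenAsymptoticsFactorial.lean`, from
  `Literature.NumberTheory.LFunctions.xiTaylorCoeff_logRatio_holds`) fed into the general real-variable theorem
  `Literature.Analysis.TotalPositivity.ToeplitzAsymp.det_toeplitz_eventually_pos`
  (`ToeplitzMinorAsymptotics.lean`: Hermite-type profile ⇒ consecutive Toeplitz minors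
  eventually positive), with `γ(n) > 0` (`Literature.NumberTheory.LFunctions.xiTaylorCoeff_pos_holds`);
* `katkova_apf_of_consecutive_minors_pos`: Katkova's Theorem D step, by Fekete's criterion
  `Literature.Analysis.TotalPositivity.det_submatrix_pos_of_contiguous` (`FeketeCriterion.lean`, proved);
* `katkova_apf_holds : katkova_apf`.

## References

* O. M. Katkova, *Multiple positivity and the Riemann zeta-function*, Comput. Methods Funct.
  Theory 7 (2007) 13–31, §1 (eq. (3)–(6), Thm. ASWE, Thm. C and the sentence following it);
  arXiv:math/0505174, pp. 3–4. [Katkova2006]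
* M. Aissen, A. Edrei, I. J. Schoenberg, A. Whitney, *On the generating functions of totally
  positive sequences*, Proc. Nat. Acad. Sci. USA 37 (1951) 303–307, Thm. 5.
  [AissenEdreiSchoenbergWhitney1951]
* E. C. Titchmarsh, *The Theory of the Riemann Zeta-Function*, 2nd ed. (1986), §2.1 (2.1.4),
  §2.12. [Titchmarsh1986]
-/

noncomputable section

open Complex Filter
open scoped Nat Topology

namespace Literature.NumberTheory.LFunctions

open Literature.Analysis.TotalPositivity

/-! ### Taylor coefficients of `ξ₁ = xiSq` at `0` -/

/-- `ξ₁` is the sum of its power series `Σ bₙ zⁿ` on all of `ℂ`. [folklore] -/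
theorem hasFPowerSeriesOnBall_xiSq :
    HasFPowerSeriesOnBall xiSq (FormalMultilinearSeries.ofScalars ℂ xiSqCoeff) 0 ⊤ := by
  have h := (FormalMultilinearSeries.ofScalars ℂ xiSqCoeff).hasFPowerSeriesOnBall
    (by rw [xiSq_radius_eq_top]; exact ENNReal.zero_lt_top)
  rw [xiSq_radius_eq_top] at h
  exact h

/-- Taylor coefficients of `ξ₁` at `0`: `ξ₁⁽ⁿ⁾(0) = n! · bₙ`. [folklore] -/
theorem iteratedDeriv_xiSq_zero (n : ℕ) :
    iteratedDeriv n xiSq 0 = (n ! : ℂ) * xiSqCoeff n := by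
  have h := hasFPowerSeriesOnBall_xiSq.factorial_smul 1 n
  rw [iteratedDeriv_eq_iteratedFDeriv, ← h, FormalMultilinearSeries.ofScalars_apply_eq]
  simp [nsmul_eq_mul]

/-- `bₙ = γ(n)/(8·n!)` is a real number. [folklore] -/
theorem xiSqCoeff_eq_ofReal (n : ℕ) :
    xiSqCoeff n = ((xiTaylorCoeff n / (8 * (n ! : ℝ)) : ℝ) : ℂ) := by
  simp only [xiSqCoeff, Complex.ofReal_div, Complex.ofReal_mul, Complex.ofReal_natCast,
    Complex.ofReal_ofNat]

/-- The Taylor coefficients of `ξ₁` at `0` are real [Katkova 2006, §1: `ξ` has real Taylor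
coefficients, eq. (4)–(6)]. [folklore] -/
theorem im_iteratedDeriv_xiSq (n : ℕ) : (iteratedDeriv n xiSq 0).im = 0 := by
  rw [iteratedDeriv_xiSq_zero, xiSqCoeff_eq_ofReal, ← Complex.ofReal_natCast, ← Complex.ofReal_mul,
    Complex.ofReal_im]

/-- The normalised Taylor sequence of `ξ₁` is `bₙ = 8⁻¹ aₙ`, `aₙ = γ(n)/n!`. [folklore] -/
theorem re_iteratedDeriv_xiSq_div (n : ℕ) :
    (iteratedDeriv n xiSq 0).re / (n ! : ℝ) = 8⁻¹ * (xiTaylorCoeff n / (n ! : ℝ)) := by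
  rw [iteratedDeriv_xiSq_zero, xiSqCoeff_eq_ofReal, ← Complex.ofReal_natCast, ← Complex.ofReal_mul,
    Complex.ofReal_re]
  have : (n ! : ℝ) ≠ 0 := by exact_mod_cast n.factorial_ne_zero
  field_simp

/-! ### Zeros of `ξ₁` and RH (Pólya's half) -/

/-- RH `↔` every zero of `z ↦ ξ(1/2 + z)` is purely imaginary. From `riemannXi_eq_zero_iff_holds`
(RiemannXiProofs.lean: the zeros of `ξ` are the zeros of `ζ` in `0 < re s < 1`) and the strip
form of RH (`riemannHypothesis_iff_strip_holds`, GeneralizedRH.lean).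
[Katkova 2006, §1, sentence after eq. (5)] [folklore] -/
theorem riemannHypothesis_iff_re_eq_zero :
    RiemannHypothesis ↔ ∀ z : ℂ, riemannXi (1 / 2 + z) = 0 → z.re = 0 := by
  rw [show RiemannHypothesis ↔ RiemannHypothesisStrip from riemannHypothesis_iff_strip_holds]
  constructor
  · intro h z hz
    obtain ⟨hζ, h0, h1⟩ := (riemannXi_eq_zero_iff_holds _).1 hz
    have := h _ hζ h0 h1
    simp at this
    linarith
  · intro h s hs h0 h1
    have hξ : riemannXi (1 / 2 + (s - 1 / 2)) = 0 := by
      rw [add_sub_cancel]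
      exact (riemannXi_eq_zero_iff_holds s).2 ⟨hs, h0, h1⟩
    have := h _ hξ
    simp at this
    linarith

/-- A complex square `z²` is real and `≤ 0` iff `z` is purely imaginary. [folklore] -/
theorem sq_im_eq_zero_and_re_nonpos_iff (z : ℂ) :
    ((z ^ 2).im = 0 ∧ (z ^ 2).re ≤ 0) ↔ z.re = 0 := by
  have hre : (z ^ 2).re = z.re * z.re - z.im * z.im := by simp [sq]
  have him : (z ^ 2).im = 2 * (z.re * z.im) := by simp [sq]; ring
  rw [hre, him]
  constructor
  · rintro ⟨h1, h2⟩
    rcases mul_eq_zero.1 ((mul_eq_zero.1 h1).resolve_left two_ne_zero) with h | h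
    · exact h
    · rw [h, mul_zero, sub_zero] at h2
      nlinarith
  · intro h
    rw [h]
    constructor
    · simp
    · nlinarith [mul_self_nonneg z.im]

/-- Every complex number is a square. [folklore] -/
theorem exists_sq_eq (w : ℂ) : ∃ z : ℂ, z ^ 2 = w :=
  ⟨w ^ ((2 : ℕ)⁻¹ : ℂ), by exact_mod_cast Complex.cpow_nat_inv_pow w two_ne_zero⟩

/-- **RH ⇔ all zeros of `ξ₁` are real and non-positive** [Katkova 2006, §1, after eq. (6): "the
Riemann Hypothesis is equivalent to the statement that `ξ₁` has only real negative zeros"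
(Pólya)]; via `riemannHypothesis_iff_re_eq_zero` and `ξ₁(z²) = ξ(1/2 + z)` (`xiSq_sq`).
[folklore] -/
theorem xiSq_zeros_iff_riemannHypothesis :
    (∀ w : ℂ, xiSq w = 0 → w.im = 0 ∧ w.re ≤ 0) ↔ RiemannHypothesis := by
  rw [riemannHypothesis_iff_re_eq_zero]
  constructor
  · intro h z hz
    have hw : xiSq (z ^ 2) = 0 := by rw [xiSq_sq, hz]
    exact (sq_im_eq_zero_and_re_nonpos_iff z).1 (h _ hw)
  · intro h w hw
    obtain ⟨z, rfl⟩ := exists_sq_eq w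
    refine (sq_im_eq_zero_and_re_nonpos_iff z).2 (h z ?_)
    rw [← xiSq_sq]
    exact hw

/-! ### Order `< 1` -/

/-- **`ξ₁` is entire of order `< 1`** (indeed `1/2`, [Katkova 2006, §1, after eq. (6)];
[Titchmarsh 1986, §2.12: "`Ξ(√z)` is an integral function of order `1/2`"]): packaged from
`differentiable_xiSq` and `norm_xiSq_le` (`‖ξ₁ w‖ ≤ C exp(‖w‖^{7/8})`). [folklore] -/
theorem isEntireOfOrderLtOne_xiSq : IsEntireOfOrderLtOne xiSq := by
  obtain ⟨C, hC⟩ := norm_xiSq_le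
  exact ⟨differentiable_xiSq, 7 / 8, C, by norm_num, hC⟩

/-! ### `ξ₁(0) = ξ(1/2) > 0` -/

/-- `Γ_ℝ(1/2) = π^{-1/4} Γ(1/4)`, a positive real number. [folklore] -/
theorem Gammaℝ_half_eq :
    Gammaℝ (1 / 2) = ((Real.pi ^ (-(1 / 4) : ℝ) * Real.Gamma (1 / 4) : ℝ) : ℂ) := by
  rw [Gammaℝ_def]
  have h1 : (-(1 / 2 : ℂ) / 2) = ((-(1 / 4) : ℝ) : ℂ) := by push_cast; ring
  have h2 : ((1 / 2 : ℂ) / 2) = ((1 / 4 : ℝ) : ℂ) := by push_cast; ring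
  rw [h1, h2, ← Complex.ofReal_cpow Real.pi_pos.le, Complex.Gamma_ofReal]
  push_cast
  ring

/-- **`ξ(1/2) > 0`** (real part; `ξ` is real on the real axis) [Katkova 2006, §1: "`ξ₁(0) > 0`"]:
`ξ(1/2) = -Γ_ℝ(1/2) ζ(1/2)/8` with `Γ_ℝ(1/2) > 0` and `ζ(1/2) < 0`
(`riemannZeta_re_neg_of_pos_of_lt_one`, [Titchmarsh 1986, §2.12, text after (2.12.4)]).
[folklore] -/
theorem riemannXi_half_re_pos : 0 < (riemannXi (1 / 2)).re := by
  have hζ : riemannZeta (1 / 2) = completedRiemannZeta (1 / 2) / Gammaℝ (1 / 2) :=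
    riemannZeta_def_of_ne_zero (by norm_num)
  have hG : Gammaℝ (1 / 2) ≠ 0 := Gammaℝ_ne_zero_of_re_pos (by norm_num)
  have hΛ : completedRiemannZeta (1 / 2) = Gammaℝ (1 / 2) * riemannZeta (1 / 2) := by
    rw [hζ]; field_simp
  have hξ : riemannXi (1 / 2) = ((-(1 / 8) : ℝ) : ℂ) * (Gammaℝ (1 / 2) * riemannZeta (1 / 2)) := by
    rw [riemannXi_eq_mul_completedRiemannZeta (by norm_num) (by norm_num), hΛ]
    push_cast; ring
  set g : ℝ := Real.pi ^ (-(1 / 4) : ℝ) * Real.Gamma (1 / 4) with hg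
  have hgpos : 0 < g :=
    mul_pos (Real.rpow_pos_of_pos Real.pi_pos _) (Real.Gamma_pos_of_pos (by norm_num))
  rw [hξ, Gammaℝ_half_eq, ← hg, Complex.re_ofReal_mul, Complex.re_ofReal_mul]
  have hz : (riemannZeta (1 / 2)).re < 0 := by
    have := riemannZeta_re_neg_of_pos_of_lt_one (σ := 1 / 2) (by norm_num) (by norm_num)
    push_cast at this
    exact this
  have : g * (riemannZeta (1 / 2)).re < 0 := mul_neg_of_pos_of_neg hgpos hz
  linarith

/-- **`γ(0) = 8 ξ(1/2) > 0`**: the instance `n = 0` of the named fact `Literature.NumberTheory.LFunctions.xiTaylorCoeff_pos`,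
proved. [folklore] -/
theorem xiTaylorCoeff_zero_pos : 0 < xiTaylorCoeff 0 := by
  rw [xiTaylorCoeff]
  simp only [Nat.factorial_zero, mul_zero, Nat.cast_one, iteratedDeriv_zero]
  norm_num
  exact riemannXi_half_re_pos

/-- **`ξ₁(0) > 0`** [Katkova 2006, §1: "Since `ξ₁(0) > 0` …"]: `0 < Re ξ₁(0) = Re ξ(1/2)`.
[folklore] -/
theorem xiSq_zero_re_pos : 0 < (xiSq 0).re := by
  rw [xiSq_zero]
  exact riemannXi_half_re_pos

/-! ### Assembly -/

/-- Rescaling by `8`: the Taylor sequence `(bₙ) = (ξ₁⁽ⁿ⁾(0)/n!)` of `ξ₁` is a Pólya frequency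
sequence iff `(aₙ) = (γ(n)/n!) = (8 bₙ)` is (`IsPolyaFrequencySeq.smul` with `8`, `8⁻¹ ≥ 0`).
[folklore] -/
theorem isPolyaFrequencySeq_taylor_xiSq_iff :
    IsPolyaFrequencySeq (fun n => (iteratedDeriv n xiSq 0).re / (n ! : ℝ)) ↔
      IsPolyaFrequencySeq (fun n => xiTaylorCoeff n / (n ! : ℝ)) := by
  have hfun : (fun n => (iteratedDeriv n xiSq 0).re / (n ! : ℝ)) =
      fun n => 8⁻¹ * (xiTaylorCoeff n / (n ! : ℝ)) := funext re_iteratedDeriv_xiSq_div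
  rw [hfun]
  constructor
  · intro h
    have h8 : IsPolyaFrequencySeq (fun n => 8 * (8⁻¹ * (xiTaylorCoeff n / (n ! : ℝ)))) :=
      h.smul (by norm_num)
    have hf : (fun n => 8 * (8⁻¹ * (xiTaylorCoeff n / (n ! : ℝ)))) =
        fun n => xiTaylorCoeff n / (n ! : ℝ) := by
      funext n; ring
    rwa [hf] at h8
  · intro h
    exact h.smul (by norm_num)

/-- **Katkova's equivalence reduced to Thm. C** [Katkova 2006, §1, Thm. C and the sentence
following it]: given the ASWE/Hadamard consequence for entire functions of order `< 1`
(`pf_taylor_iff_zeros_of_order_lt_one`, applied to `F = ξ₁ = xiSq`, which is entire of order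
`< 1` with real Taylor coefficients and `ξ₁(0) > 0`), RH `⇔ (γ(n)/n!)` is a Pólya frequency
sequence, i.e. the named fact `katkova_rh_iff_pf`. [cite: Katkova2006, §1 Thm. C] -/
theorem katkova_rh_iff_pf_of_pf_taylor (hpf : pf_taylor_iff_zeros_of_order_lt_one) :
    katkova_rh_iff_pf := by
  have key := hpf xiSq isEntireOfOrderLtOne_xiSq im_iteratedDeriv_xiSq xiSq_zero_re_pos
  rw [isPolyaFrequencySeq_taylor_xiSq_iff, xiSq_zeros_iff_riemannHypothesis,
    isPolyaFrequencySeq_xi_iff] at key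
  unfold katkova_rh_iff_pf
  rw [← key]
  exact Iff.rfl

/-- **Katkova's equivalence, discharged** [Katkova 2006, §1, Thm. C and the sentence following
it: "So, the Riemann Hypothesis is equivalent to statement that `ξ₁ ∈ PF_∞`"]: RH holds iff
every minor of the lower-triangular Toeplitz matrix of `(γ(n)/n!)` is `≥ 0`. Inputs, all proved
in the tree: Pólya's half (`xiSq_zeros_iff_riemannHypothesis`), the order of `ξ₁`
(`isEntireOfOrderLtOne_xiSq`, from `riemannXi_order_le_one_holds`, Titchmarsh Thm. 2.12),
`ξ₁(0) = ξ(1/2) > 0` (`xiSq_zero_re_pos`), Hadamard's genus-zero factorisation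
(`Literature.Analysis.Complex.hadamard_genus_zero_holds`, Conway XI.3.4) and the entire genus-zero case of the
Aissen–Edrei–Schoenberg–Whitney theorem (`pf_taylor_iff_zeros_of_order_lt_one_of_hadamard`,
AESW 1951 Thm. 5). [cite: Katkova2006, §1 Thm. C] -/
theorem katkova_rh_iff_pf_holds : katkova_rh_iff_pf :=
  katkova_rh_iff_pf_of_pf_taylor
    (pf_taylor_iff_zeros_of_order_lt_one_of_hadamard Literature.Analysis.Complex.hadamard_genus_zero_holds)

/-- **RH ⇔ `(γ(n)/n!)ₙ` is a Pólya frequency sequence** (Katkova's `RH ⇔ ξ₁ ∈ PF_∞` in the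
vocabulary of `PolyaFrequency.lean`), unconditionally. [cite: Katkova2006, §1 Thm. C] -/
theorem riemannHypothesis_iff_isPolyaFrequencySeq_xi :
    RiemannHypothesis ↔ IsPolyaFrequencySeq (fun n => xiTaylorCoeff n / (n ! : ℝ)) :=
  katkova_rh_iff_pf_holds.iff_isPolyaFrequencySeq

/-! ### Katkova's Theorem 2: `ξ₁ ∈ APF_m` for every `m` -/

section KatkovaThm2

open Filter Topology Asymptotics Finset

/-- **Katkova's Theorem D step, proved** [Katkova 2006, §2, arXiv p. 5: "By Proposition 1 and
Lemma 2 `∀ m ∃ N(m) ∀ k ≥ N(m) ∀ ν = 1, …, m ⟹ A_k^ν(f¹) > 0`, that is all minors of order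
`ν = 1, …, m` composed of consecutive rows and consecutive columns of matrix `A_N(f¹)` are
positive. The statement on `f¹ ∈ APF_m` means nonnegativity of all minors of matrix `A_N(f¹)`.
As a matter of fact these minors are positive. It follows from … Theorem D"]: the named fact
`katkova_consecutive_minors_pos` implies the named fact `katkova_apf`. With `N(m)` from the
former take `N := N(m) + 2m`; a contiguous `ν × ν` block of `A_N = (a_{N+j-l})_{l<m, j<Q}` with
corner `(l₀, j₀)` is the consecutive Toeplitz minor `A_k^ν`, `k = N + j₀ - l₀ ≥ N(m)`, hence
`> 0`, and Fekete's criterion (`Literature.Analysis.TotalPositivity.det_submatrix_pos_of_contiguous`,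
`FeketeCriterion.lean` = Thm. D) makes every minor of `A_N` positive, in particular `≥ 0`.
[cite: Katkova2006, §2 Thm. D] -/
theorem katkova_apf_of_consecutive_minors_pos (h : katkova_consecutive_minors_pos) :
    katkova_apf := by
  intro m
  obtain ⟨N₀, hN₀⟩ := h m
  refine ⟨N₀ + 2 * m, fun k l j hl hj hlm => ?_⟩
  set N := N₀ + 2 * m with hN
  -- a bound for the column indices
  set Q : ℕ := (∑ q, j q) + 1 with hQ
  have hjQ : ∀ q, j q < Q := fun q => by
    have := Finset.single_le_sum (fun q _ => Nat.zero_le (j q)) (Finset.mem_univ q)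
    omega
  -- Katkova's matrix `A_N` (truncated to `Q` columns) and its contiguous minors
  set B : Matrix (Fin m) (Fin Q) ℝ := Matrix.of fun (l : Fin m) (j : Fin Q) =>
    xiTaylorCoeff (N + j - l) / ((N + j - l)! : ℝ) with hB
  have hcontig : ∀ k', k' ≤ m → ∀ (i₀ j₀ : ℕ) (hi : i₀ + k' ≤ m) (hj : j₀ + k' ≤ Q),
      0 < (B.submatrix (fun i : Fin k' => (⟨i₀ + i, by omega⟩ : Fin m))
        (fun j : Fin k' => (⟨j₀ + j, by omega⟩ : Fin Q))).det := by
    intro k' hk' i₀ j₀ hi hj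
    rcases Nat.eq_zero_or_pos k' with rfl | hpos
    · simp [Matrix.det_isEmpty]
    · have key := hN₀ (N + j₀ - i₀) (by omega) k' hpos hk'
      convert key using 2
      ext a b
      simp only [Matrix.submatrix_apply, Matrix.of_apply, hB]
      have hab : (a : ℕ) ≤ N + j₀ - i₀ + b := by omega
      have e : N + (j₀ + b) - (i₀ + a) = N + j₀ - i₀ + b - a := by omega
      rw [if_pos hab, e]
  -- the given minor is a minor of `A_N`
  set r : Fin k → Fin m := fun p => ⟨l p, hlm p⟩ with hr_def
  set c : Fin k → Fin Q := fun q => ⟨j q, hjQ q⟩ with hc_def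
  have hr : StrictMono r := fun a b hab => Fin.lt_def.2 (hl hab)
  have hc : StrictMono c := fun a b hab => Fin.lt_def.2 (hj hab)
  have hk : k ≤ m := by simpa using Fintype.card_le_of_injective r hr.injective
  have pos := det_submatrix_pos_of_contiguous B hcontig hk r c hr hc
  refine le_of_lt ?_
  convert pos using 2
  ext p q
  simp only [Matrix.of_apply, Matrix.submatrix_apply, hB, hr_def, hc_def]
  have : l p ≤ N + j q := by have := hlm p; omega
  rw [if_pos this]

/-- **Katkova's consecutive-minor statement, proved** [Katkova 2006, §2, the display following
Prop. 1, arXiv p. 5]: for every `m` there is `N(m)` with `det (a_{k+j-l})_{l,j<ν} > 0` for all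
`k ≥ N(m)` and `1 ≤ ν ≤ m`, `a_n = γ(n)/n!`. Katkova derives it from her Prop. 1 (saddle-point
asymptotics of the integrals (11)) and Lemma 2; here it is obtained from the GORZ-type expansion
`log(a_{n+j}/a_n) = A(n) j - δ(n)² j² + ∑_{i=3}^{D} gᵢ(n) jⁱ + o(δ^D)`
(`Literature.NumberTheory.LFunctions.GORZAsymp.xiTaylorCoeff_div_factorial_logRatio` with `D = 2m + 1`, resting on the tree's
proof of [GORZPNAS2019, §5.1 eq. (15)], `Literature.NumberTheory.LFunctions.xiTaylorCoeff_logRatio_holds`), positivity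
`γ(n) > 0` (`Literature.NumberTheory.LFunctions.xiTaylorCoeff_pos_holds`) and the general theorem
`Literature.Analysis.TotalPositivity.ToeplitzAsymp.det_toeplitz_eventually_pos` (a sequence with such a
Hermite-type profile has eventually positive consecutive Toeplitz minors of every fixed order),
taking the maximum of the thresholds over `ν ≤ m`. [cite: Katkova2006, §2 Prop. 1] -/
theorem katkova_consecutive_minors_pos_holds : katkova_consecutive_minors_pos := by
  classical
  intro m
  set a : ℕ → ℝ := fun n => xiTaylorCoeff n / (n ! : ℝ) with ha_def
  have ha : ∀ n, 0 < a n := fun n => div_pos (xiTaylorCoeff_pos_holds n) (by positivity)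
  obtain ⟨A, δ, g, h1, h2, h3, h4⟩ :=
    Literature.NumberTheory.LFunctions.GORZAsymp.xiTaylorCoeff_div_factorial_logRatio (2 * m + 1) (by omega)
  have key : ∀ ν : ℕ, ν ≤ m →
      ∃ N : ℕ, ∀ k : ℕ, N ≤ k → 0 < (Matrix.of fun l j : Fin ν => a (k + j - l)).det :=
    fun ν hν => ToeplitzAsymp.det_toeplitz_eventually_pos ha (by omega) h1 h2 h3 h4
  choose! Nν hNν using key
  refine ⟨(Finset.range (m + 1)).sup Nν + m, fun k hk ν hν1 hνm => ?_⟩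
  have hNk : Nν ν ≤ k := by
    have : Nν ν ≤ (Finset.range (m + 1)).sup Nν :=
      Finset.le_sup (f := Nν) (Finset.mem_range.2 (Nat.lt_succ_of_le hνm))
    omega
  have pos := hNν ν hνm k hNk
  convert pos using 2
  ext l j
  simp only [Matrix.of_apply, ha_def]
  have : (l : ℕ) ≤ k + j := by have := l.2; omega
  rw [if_pos this]

/-- **Katkova 2006, Theorem 2, discharged: `ξ₁ ∈ APF_m` for every `m ∈ ℕ`** [Katkova 2006,
Thm. 2 with Def. 3, arXiv p. 4]: in the tree's normalisation `a_n = γ(n)/n!` (`= 8 b_n`), for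
every `m` there is `N` such that every minor of the `m × ∞` matrix `A_N = (a_{N+j-l})_{l<m, j≥0}`
is `≥ 0`. Assembled from `katkova_consecutive_minors_pos_holds` (the display after Prop. 1) and
the Theorem D step `katkova_apf_of_consecutive_minors_pos` (Fekete's criterion), exactly as in
[Katkova 2006, §2, arXiv p. 5]; the consecutive-minor statement itself is proved through the
GORZ asymptotics of `γ(n)` rather than Katkova's saddle point. Inputs, all proved in the tree:
`Literature.NumberTheory.LFunctions.xiTaylorCoeff_pos_holds`, `Literature.NumberTheory.LFunctions.xiTaylorCoeff_logRatio_holds` (GORZ (15)),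
`Literature.NumberTheory.LFunctions.GORZAsymp.xiTaylorCoeff_div_factorial_logRatio`,
`Literature.Analysis.TotalPositivity.ToeplitzAsymp.det_toeplitz_eventually_pos`,
`Literature.Analysis.TotalPositivity.det_submatrix_pos_of_contiguous`. [cite: Katkova2006, Thm. 2] -/
theorem katkova_apf_holds : katkova_apf :=
  katkova_apf_of_consecutive_minors_pos katkova_consecutive_minors_pos_holds

end KatkovaThm2

end Literature.NumberTheory.LFunctions
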